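import Literature.NumberTheory.GelbartRogawski1991.ThetaDichotomyVocabulary
import HarnessLib

/-!
# [GelbartRogawski1990 Prop. 5.2.2, as recalled in GelbartRogawski1991 p. 467] At a NON-SPLIT place the local theta type
# `X_v(μ, ε, χ_f) = ω³(γ_v, ψ_v, χ_v)` of `U(3)` is SUPERCUSPIDAL iff the `U(1)`-character `ψθ = χ_v(γ_v¹)⁻¹` does NOT occur in `ω¹(γ_v, ψ_v)`

Topic `NumberTheory/GelbartRogawski1991`; namespace `Literature.NumberTheory.GelbartRogawski1991`.  ONE closed named fact
(`GR90Prop522_thetaType_supercuspidal_iff : Prop`, a `def`; no `sorry`, no instance, no notation, no theorem); net debt +1 — a PRINTED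
CITATION.  Cell `hodgecm-mathlib` (D-0151), director g16 topic T7 «GR91 §5 local theta dichotomy for the true packet `{πⁿ(ξ_v), πˢ(ξ_v)}`
(D7α local half, U′-N's sibling)», seat typ-T7a (2026-08-31), node N4 of `F0/P2/T7a-TREE.md`.  HONEST LABEL: HC_CM is proved only modulo the
printed citations until rung 0 closes; this row would be ONE more of them; nothing here proves HC_CM.

THE PRINT.  [GelbartRogawski1991] S. Gelbart, J. Rogawski, *L-functions and Fourier–Jacobi coefficients for the unitary group U(3)*, Invent. Math.
105 (1991), proof of Proposition 5.2.1, **p. 467 lines 25–27** (GDZ page image `img_p467.jpg`, read 2026-08-31): «To establish the equivalence of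
(1) and (3), recall from [GR₁, Prop. 5.2.2], that `ω³(χ_v, ψ_v, χ_v)` [sic, read `ω³(γ_v, ψ_v, χ_v)`] is supercuspidal if and only if
`χ_v(γ_v¹)⁻¹` does not occur in `ω¹(γ_v, ψ_v)`.»; p. 467 lines 8–11: «the choice of data `(γ, ψ)` simultaneously fixes embeddings of `U(1)` and
`U(3)` in their corresponding metaplectic groups.  We denote the corresponding oscillator representations by `ω¹(γ, ψ)` and `ω³(γ, ψ)`»;
p. 466 Remark: Lemma 5.1.2 «reduces to a statement about the Howe correspondence pair `(U(1), U(1))` in the local case».  [GR₁] =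
[GelbartRogawski1990] (PS-Festschrift, «Exceptional representations and Shimura's integral for the local unitary group U(3)»), Prop. 5.2.2 —
NOT HELD (acq-10743; typed from its quotation, exactly as ★ `GR91LocalPacket.gr1_prop522` of the dictionary-level skeleton
`GelbartRogawski1991/LocalAPackets.lean` did); the same statement is [Haan2015 = arXiv:1501.00885, Thm. 3.4 (ii) and its proof, p0009 L69]:
«The Proposition 5.2.2 in [Ge2] asserts that `Θ_{ψ,V₃^ε,W₁^{ε′}}(π)` is supercuspidal if and only if `Θ_{ψ,V₁^ε,W₁^{ε′}}(π ⊗ (γ_1)⁻¹) = 0`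
where `γ_1` is the restriction of `γ` to `E¹`» ([Ge2] = GelbartRogawski1990 in Haan's bibliography, p0017 L51).  The local context of print:
`E_v/F_v` a quadratic extension of `p`-adic FIELDS (non-split `v`), `U(3)` quasi-split (every rank-3 hermitian space over a `p`-adic field is
isotropic), `ω³(γ, ψ, χ)` = the `χ`-part (central character `χ`) of the oscillator representation — Liu's `X_v(μ, ε, χ_f)` [Liu2021 Def. 4.11,
App. D §D.1 Step 3] with GR's `γ ↔` Kudla's splitting character `μ_v`, GR's «`ψ` modulo `N(E_vˣ)`» `↔` the line class `ε` [Liu2021 l. 5217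
footnote], GR's central character `χ_v ↔ χ_{f,v}`; hence GR's tested character `χ_v(γ_v¹)⁻¹ = χ_v · (γ_v|_{E¹})⁻¹ ↔ ψθ = χ_{f,v} · μ_v⁻¹|_{E¹_v}`
(★ `IsThetaCenterChar`), and `ω¹(γ_v, ψ_v)` = the rank-one Weil representation of the pair `(U(L₀), U(W_ε))`, `L₀` the Witt kernel line of
`V = diag dV` (★ `kernelLineCM`), at the same splitting character (★ `lineWeilCM`) — the MECHANISM being the Jacquet module of `ω³` along the Borel
[GR91 §3.2 (3.2.1)–(3.2.3): `ω³_N ≅ ℱ` with `d(α, β, ᾱ⁻¹)` acting by `γ(α)‖α‖^{1/2} ω¹(β)`; Kudla1986 Thm. 2.8] followed by Harish-Chandra's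
criterion (sibling letters `thetaType_nonsplit_jacquetModule`, ★-typed `u3_isSupercuspidal_iff_jacquet_eq_zero`).

AUDIT T7-K0 (cheap falsifier, recommended BEFORE paying consumers; not load-bearing): at a place `v` with ALL data unramified (`L_w/L⁺_v`
unramified, `μ_v`, `χ_{f,v}` unramified, `dV i`, `ε` units, `ψ_v` of conductor `𝒪`), `X_v(μ, 1, χ_f)` is the spherical `πⁿ` (★ `LocalTypeSphericalAlmostAll`
road), so this letter predicts «`ψθ = 1` OCCURS in `ω¹` for the unit line» — a rank-one lattice computation in the tree's Schrödinger model
(★ `RankOneOscillatorMultiplicityOne`, `RationalSymplecticUnramifiedVector`).  A failure there means a slip in MY dictionary (`kernelLineCM`'s class or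
`μ_v` vs `μ_v⁻¹` in `ψθ`), to be corrected under a NEW name — never a defect of print.

SCOPE ∕ NOT ASSERTED: nothing at split `v` (there `X_v` is a constituent of a unitary parabolic induction from `P_{2,1}` of `GL₃`, never
supercuspidal — ★ `splitPlace_chiCoinv_iso_parabolicIndGL_holds`); no claim WHICH class `ε` is the supercuspidal one (the ε-sign
[HarrisKudlaSweet1996 Thm. 6.1, «n = 1 by Rogawski»] is not typed); no Haar measure; supercuspidality is the INTRINSIC predicate ★
`Representation.IsSupercuspidal` of `X_v` on `U(diag dV)(L⁺_v)` (class-level ∕ transported forms follow from ★ `IsSupercuspidal.of_equiv` and conjugation).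

* `GR90Prop522_thetaType_supercuspidal_iff` — the named fact (closed `Prop`).

## References
* [GelbartRogawski1991] Invent. Math. 105 (1991): proof of Prop. 5.2.1 p. 467 L25–27; p. 467 L8–11; Remark p. 466; §3.2 (3.2.1)–(3.2.3) p. 457.
* [GelbartRogawski1990] Israel Math. Conf. Proc. 2 (1990) 19–75: Prop. 5.2.2 (cited through GR91 p. 467 and Haan2015; not held, acq-10743).
* [Haan2015] J. Haan, arXiv:1501.00885: Thm. 3.4 (ii) and proof (held `paper:arxiv-1501.00885`, p0009 L57–69; bibliography p0017 L49–59).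
* [Kudla1986] S. Kudla, Invent. Math. 83 (1986), Thm. 2.8.  [MoeglinVignerasWaldspurger1987] LNM 1291, Chap. 3 §IV.
* [Liu2021] arXiv:2102.11518: Def. 4.11; App. D §D.1 Steps 1–3 (l. 5217–5221).
-/

set_option autoImplicit false

noncomputable section

open NumberField IsDedekindDomain MeasureTheory
open scoped Matrix Kronecker

namespace Literature.NumberTheory.GelbartRogawski1991

open Literature.NumberTheory Literature.NumberTheory.Automorphic Literature.NumberTheory.Automorphic.UnitaryGroup
open Literature.NumberTheory.Automorphic.IdeleClassGroup
open Literature.NumberTheory.Automorphic.Liu2021 Literature.NumberTheory.Automorphic.Liu2021.Def411WeilCarriers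
open Literature.NumberTheory.GaloisRepresentations
open Literature.NumberTheory.Rogawski1990

/-! ## §1 The named fact -/

set_option synthInstance.maxHeartbeats 400000 in
set_option maxHeartbeats 8000000 in
/-- **[GelbartRogawski1990 Prop. 5.2.2, as recalled in GelbartRogawski1991 p. 467 L25–27] — SUPERCUSPIDALITY CRITERION FOR THE LOCAL THETA TYPE
AT A NON-SPLIT PLACE.**  For every CM field `L`, rational theta frame data `(e₁, dV)` (`dV` `c̄`-fixed and non-zero: the hermitian space
`V = diag dV` of rank 3), auxiliary reindexing `e₀` of the rank-(1,1) package, conjugate-symplectic `μ` (Kudla's splitting character = GR's `γ`),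
continuous unitary character `χ_f` of `U(1)(𝔸_{L⁺,f})` (GR's central character `χ`), every place `v` of `L⁺` that does NOT split in `L`, every line
class `ε ∈ (L⁺)ˣ` (GR's class of `ψ_v` modulo `N(E_vˣ)`) and every character `ψθ` of `E¹_v` with `ψθ = χ_{f,v} · μ_v⁻¹` on `U((ε))(L⁺_v)`
(★ `IsThetaCenterChar`; GR's `χ_v(γ_v¹)⁻¹`): Liu's local theta type `X_v(μ, ε, χ_f)` (★ `xThetaCM`; GR's `ω³(γ_v, ψ_v, χ_v)`) is SUPERCUSPIDAL
(★ `Representation.IsSupercuspidal`: all smooth matrix coefficients compactly supported modulo the centre) IF AND ONLY IF `ψθ` does NOT occur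
(★ `OccursInLineWeilCM`: zero weight space) in the rank-one Weil representation `ω¹(γ_v, ψ_v)` of `E¹_v` attached to the Witt kernel line
`L₀ = ⟨−d₁d₂d₃⟩` of `V` and the line `⟨ε⟩` at the same `μ` (★ `lineWeilCM … (kernelLineCM dV) … μ hμ ε v`).  «recall from [GR₁, Prop. 5.2.2], that
`ω³(γ_v, ψ_v, χ_v)` is supercuspidal if and only if `χ_v(γ_v¹)⁻¹` does not occur in `ω¹(γ_v, ψ_v)`.»  Consumed by topic T7's pay-down line with
the ★ `(U(1),U(1))` dichotomy `rankOne_theta_dichotomy` («exactly one class `ε` occurs») to give «exactly one of `X_v(μ, ε₁, χ_f)`, `X_v(μ, ε₂, χ_f)`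
is supercuspidal» = `πˢ(ξ_v)`; nothing in the tree proves it.  Dictionary slips (`kernelLineCM`, `μ_v^{±1}`) are MINE and auditable (module
docstring, AUDIT T7-K0). [cite: GelbartRogawski1991, proof of Prop. 5.2.1 p. 467 L25–27; p. 467 L8–11; Remark p. 466]
[cite: GelbartRogawski1990, Prop. 5.2.2] [cite: Haan2015, Thm. 3.4 (ii)] [cite: Liu2021, Def. 4.11; App. D §D.1 Step 3 (l. 5221)] -/
def GR90Prop522_thetaType_supercuspidal_iff : Prop :=
  ∀ (L : Type) [Field L] [NumberField L] [IsCMField L]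
    {n' : ℕ} (e₁ : Fin 3 × Fin 1 ≃ Fin n') (dV : Fin 3 → L) (hdV : ∀ i, IsCMField.complexConj L (dV i) = dV i) (hdV0 : ∀ i, dV i ≠ 0)
    {n₀ : ℕ} (e₀ : Fin 1 × Fin 1 ≃ Fin n₀)
    (μ : Literature.NumberTheory.Automorphic.IdeleClassGroup L →ₜ* Circle) (hμ : IsConjugateSymplectic L μ)
    (χf : UnitaryGroup.finAdelicOne (↥(maximalRealSubfield L)) L (IsCMField.complexConj L) →* ℂˣ),
    Continuous χf → (∀ z, ‖((χf z : ℂˣ) : ℂ)‖ = 1) →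
    ∀ (v : HeightOneSpectrum (𝓞 ↥(maximalRealSubfield L))),
      (∀ w : PlacesOver L v, IsCMField.complexConj L • w.1 = w.1) →
      ∀ (ε : (↥(maximalRealSubfield L))ˣ) (ψθ : ↥(normOneUnits (conjLocal L (IsCMField.complexConj L) v)) →* ℂˣ),
        IsThetaCenterChar L μ χf ε v ψθ →
        ((xThetaCM L e₁ dV hdV hdV0 μ hμ χf ε v).IsSupercuspidal ↔
          ¬ OccursInLineWeilCM L e₀ (kernelLineCM dV) (complexConj_kernelLineCM dV hdV) (kernelLineCM_ne_zero dV hdV0) μ hμ ε v ψθ)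

end Literature.NumberTheory.GelbartRogawski1991

end
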